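import Mathlib.LinearAlgebra.Matrix.Charpoly.Coeff
import HarnessLib

/-!
# Samuelson's identity and Berkowitz's recursion for the characteristic polynomial

The algebra behind Berkowitz's division-free algorithm for the characteristic polynomial
(Berkowitz 1984; exposition followed: Soltys 2002, §2). For a square matrix bordered by its last
row and column,
`A = [[M, S], [R, a]]` (`M = A.submatrix castSucc castSucc`, `R_j = A last j`, `S_i = A i last`,
`a = A last last`; Soltys borders by the FIRST row and column, which is the same statement up to
the order-reversing re-indexing of `Fin (m+1)`):

* `det_eq_border_last` — the bordered-determinant (Cauchy) expansion
  `det B = b · det N − R · adj(N) · S` for `B = [[N, S], [R, b]]`, by two Laplace expansions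
  (Soltys 2002, proof of Lemma 1);
* `charpoly_eq_samuelson` — **Samuelson's identity**
  `χ_A = (X − a) χ_M − R · adj(X·1 − M) · S` (Soltys 2002, §2, Lemma 1);
* `adjugate_charmatrix` — `adj(X·1 − M) = ∑_{k=1}^{m} c_k ∑_{l<k} X^l M^{k-1-l}` where
  `χ_M = ∑_k c_k X^k` (Soltys 2002, §2, Lemma 2: "`B(x) = adj(xI − M)`", via Cayley–Hamilton);
* `charpoly_eq_berkowitz`, `charpoly_coeff_eq_berkowitz` — the resulting recursion
  `χ_A = (X − a) χ_M − ∑_{k} ∑_{l<k} c_k (R M^{k-1-l} S) X^l` (Soltys 2002, §2, eq. (4) =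
  "(eq:berk)", the basis of Berkowitz's algorithm, ibid. Def. 2), and coefficientwise
  `[X^l] χ_A = c_{l-1} − a c_l − ∑_{l<k≤m} c_k · (R M^{k-l-1} S)` — one column of Berkowitz's
  lower-triangular Toeplitz matrix `(1, −a, −RS, −RMS, −RM²S, …)`.

Everything is over an arbitrary commutative ring (no divisions occur). Mathlib has the
characteristic matrix/polynomial, the adjugate, Laplace expansion along any row/column and
Cayley–Hamilton (`Matrix.aeval_self_charpoly`), but neither Samuelson's identity nor the adjugate
of the characteristic matrix (searched: `adjugate_charmatrix`, `charpoly_fromBlocks`,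
`Samuelson`, `Berkowitz`). This file is used by
`Literature/Computability/AlgebraicComplexity/DetInVP.lean` (`DET ∈ VP`).

## References

* [Berkowitz1984] S. J. Berkowitz, *On computing the determinant in small parallel time using a
  small number of processors*, Inform. Process. Lett. 18 (1984) 147–150.
* [Soltys2002] M. Soltys, *Berkowitz's algorithm and clow sequences*, Electron. J. Linear
  Algebra 9 (2002) 42–54, §2 (Lemma 1 = Samuelson's identity, Lemma 2, eq. (eq:berk), Def. 2).
-/

namespace Literature.LinearAlgebra.Matrix

open _root_.Matrix _root_.Polynomial Finset

variable {R : Type*} [CommRing R]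

/-! ### The bordered determinant -/

section Border

variable {m : ℕ}

/-- Inner Laplace expansion used in `det_eq_border_last`: deleting the last row and the column
`castSucc j` of an `(m+2) × (m+2)` matrix `B` and expanding along the (remaining) last column
gives `(-1)^{m+j} ∑_i adj(N)_{j i} B_{i, last}`, `N = B.submatrix castSucc castSucc`
(Soltys 2002, proof of Lemma 1, second expansion). [cite: Soltys2002, §2 Lemma 1 (proof)] -/
theorem det_submatrix_castSucc_succAbove (B : Matrix (Fin (m + 2)) (Fin (m + 2)) R)
    (j : Fin (m + 1)) :
    (B.submatrix Fin.castSucc (Fin.castSucc j).succAbove).det =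
      (-1) ^ (m + j : ℕ) * ∑ i : Fin (m + 1),
        (B.submatrix Fin.castSucc Fin.castSucc).adjugate j i *
          B (Fin.castSucc i) (Fin.last (m + 1)) := by
  rw [Matrix.det_succ_column _ (Fin.last m), Finset.mul_sum]
  refine Finset.sum_congr rfl fun i _ => ?_
  have h1 : (Fin.castSucc j).succAbove (Fin.last m) = Fin.last (m + 1) := by
    rw [Fin.succAbove_of_le_castSucc _ _ (Fin.castSucc_le_castSucc_iff.2 (Fin.le_last j)),
      Fin.succ_last]
  have h2 : (B.submatrix Fin.castSucc (Fin.castSucc j).succAbove).submatrix i.succAbove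
        (Fin.last m).succAbove =
      (B.submatrix Fin.castSucc Fin.castSucc).submatrix i.succAbove j.succAbove := by
    ext a b
    simp only [Matrix.submatrix_apply, Fin.succAbove_last, Fin.castSucc_succAbove_castSucc]
  rw [Matrix.submatrix_apply, h1, h2, Matrix.adjugate_fin_succ_eq_det_submatrix, Fin.val_last]
  have hs : (-1 : R) ^ (m + j : ℕ) * (-1) ^ (i + j : ℕ) = (-1) ^ (i + m : ℕ) := by
    rw [← pow_add, show (m + j + (i + j) : ℕ) = 2 * j + (i + m) by ring, pow_add, pow_mul,
      neg_one_sq, one_pow, one_mul]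
  rw [← hs]
  ring

/-- **Bordered determinant** (Cauchy expansion along the last row and column): for
`B = [[N, S], [R, b]]` with `N = B.submatrix castSucc castSucc`, `b = B last last`,
`R_j = B last j`, `S_i = B i last`,
`det B = b · det N − ∑_{j,i} R_j · adj(N)_{j i} · S_i` (Soltys 2002, proof of Lemma 1, stated
there for the bordering by the first row and column). [cite: Soltys2002, §2 Lemma 1 (proof)] -/
theorem det_eq_border_last (B : Matrix (Fin (m + 1)) (Fin (m + 1)) R) :
    B.det = B (Fin.last m) (Fin.last m) * (B.submatrix Fin.castSucc Fin.castSucc).det -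
      ∑ j : Fin m, ∑ i : Fin m, B (Fin.last m) (Fin.castSucc j) *
        (B.submatrix Fin.castSucc Fin.castSucc).adjugate j i * B (Fin.castSucc i) (Fin.last m) := by
  rw [Matrix.det_succ_row B (Fin.last m), Fin.sum_univ_castSucc]
  simp only [Fin.succAbove_last, Fin.val_last, Fin.val_castSucc]
  have hl : (-1 : R) ^ (m + m) = 1 := by rw [← two_mul, pow_mul, neg_one_sq, one_pow]
  rw [hl, one_mul, add_comm, sub_eq_add_neg, ← Finset.sum_neg_distrib]
  congr 1
  refine Finset.sum_congr rfl fun j _ => ?_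
  cases m with
  | zero => exact j.elim0
  | succ m =>
    rw [det_submatrix_castSucc_succAbove, Finset.mul_sum, Finset.mul_sum,
      ← Finset.sum_neg_distrib]
    refine Finset.sum_congr rfl fun i _ => ?_
    have hs : (-1 : R) ^ (m + 1 + j : ℕ) * (-1) ^ (m + j : ℕ) = -1 := by
      rw [← pow_add, show (m + 1 + j + (m + j) : ℕ) = 2 * (m + j) + 1 by ring, pow_add, pow_mul,
        neg_one_sq, one_pow, one_mul, pow_one]
    linear_combination (B (Fin.last (m + 1)) (Fin.castSucc j) *
      ((B.submatrix Fin.castSucc Fin.castSucc).adjugate j i *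
        B (Fin.castSucc i) (Fin.last (m + 1)))) * hs

end Border

/-! ### Samuelson's identity -/

section Samuelson

/-- The characteristic matrix commutes with passing to a principal submatrix along an injective
re-indexing. [folklore] -/
theorem charmatrix_submatrix {l n : Type*} [Fintype l] [DecidableEq l] [Fintype n]
    [DecidableEq n] (A : Matrix n n R) {f : l → n} (hf : Function.Injective f) :
    (Matrix.charmatrix A).submatrix f f = Matrix.charmatrix (A.submatrix f f) := by
  ext i j
  by_cases h : i = j
  · subst h
    simp only [Matrix.submatrix_apply, Matrix.charmatrix_apply_eq]
  · rw [Matrix.submatrix_apply, Matrix.charmatrix_apply_ne _ _ _ (hf.ne h),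
      Matrix.charmatrix_apply_ne _ _ _ h, Matrix.submatrix_apply]

variable {m : ℕ}

/-- **Samuelson's identity** (matrix form): for `A = [[M, S], [R, a]]` bordered by its last row
and column, `χ_A = (X − a) · χ_M − ∑_{j,i} R_j · adj(X·1 − M)_{j i} · S_i`
(Soltys 2002, §2, Lemma 1). [cite: Soltys2002, §2 Lemma 1] -/
theorem charpoly_eq_samuelson (A : Matrix (Fin (m + 1)) (Fin (m + 1)) R) :
    A.charpoly =
      (X - C (A (Fin.last m) (Fin.last m))) * (A.submatrix Fin.castSucc Fin.castSucc).charpoly -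
        ∑ j : Fin m, ∑ i : Fin m, C (A (Fin.last m) (Fin.castSucc j)) *
          (Matrix.charmatrix (A.submatrix Fin.castSucc Fin.castSucc)).adjugate j i *
            C (A (Fin.castSucc i) (Fin.last m)) := by
  have hsub := charmatrix_submatrix A (Fin.castSucc_injective m)
  unfold Matrix.charpoly
  rw [det_eq_border_last, hsub, Matrix.charmatrix_apply_eq]
  refine congrArg₂ (· - ·) rfl ?_
  refine Finset.sum_congr rfl fun j _ => Finset.sum_congr rfl fun i _ => ?_
  rw [Matrix.charmatrix_apply_ne _ _ _ (Fin.castSucc_lt_last j).ne',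
    Matrix.charmatrix_apply_ne _ _ _ (Fin.castSucc_lt_last i).ne]
  ring

end Samuelson

/-! ### The adjugate of the characteristic matrix -/

section Adjugate

variable {n : Type*} [Fintype n] [DecidableEq n]

/-- `X·1 − M` written with a scalar action instead of `Matrix.scalar`. [folklore] -/
theorem charmatrix_eq_X_smul_one_sub (M : Matrix n n R) :
    Matrix.charmatrix M = (X : R[X]) • (1 : Matrix n n R[X]) - M.map C := by
  ext i j
  by_cases h : i = j
  · subst h
    simp
  · simp [Matrix.charmatrix_apply_ne _ _ _ h, Matrix.one_apply_ne h]

/-- Telescoping: `(X·1 − Y) · ∑_{l<k} X^l Y^{k-1-l} = X^k·1 − Y^k` (Soltys 2002, proof of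
Lemma 2). [cite: Soltys2002, §2 Lemma 2 (proof)] -/
theorem X_smul_one_sub_mul_sum (Y : Matrix n n R[X]) (k : ℕ) :
    ((X : R[X]) • (1 : Matrix n n R[X]) - Y) * ∑ l ∈ range k, (X : R[X]) ^ l • Y ^ (k - (l + 1)) =
      (X : R[X]) ^ k • (1 : Matrix n n R[X]) - Y ^ k := by
  have h : ∀ l ∈ range k, ((X : R[X]) • (1 : Matrix n n R[X]) - Y) *
      ((X : R[X]) ^ l • Y ^ (k - (l + 1))) =
        (X : R[X]) ^ (l + 1) • Y ^ (k - (l + 1)) - (X : R[X]) ^ l • Y ^ (k - l) := by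
    intro l hl
    have he : k - l = k - (l + 1) + 1 := by have := mem_range.1 hl; omega
    rw [sub_mul, Matrix.smul_mul, one_mul, smul_smul, ← pow_succ' (X : R[X]) l, Matrix.mul_smul]
    conv_rhs => rw [he, pow_succ' Y]
  rw [Finset.mul_sum, Finset.sum_congr rfl h]
  have := Finset.sum_range_sub (fun l => (X : R[X]) ^ l • Y ^ (k - l)) k
  simp only [Nat.sub_self, pow_zero, Nat.sub_zero, one_smul] at this
  exact this

/-- **The adjugate of the characteristic matrix**: with `χ_M = ∑_k c_k X^k`,
`adj(X·1 − M) = ∑_{k ≤ m} c_k ∑_{l<k} X^l · M^{k-1-l}` (`m = #n`), i.e. the coefficient of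
`X^l` is `∑_{k>l} c_k M^{k-1-l}` (Soltys 2002, §2, Lemma 2, "`B(x) = adj(xI − M)`": multiply by
`X·1 − M`, telescope, and use Cayley–Hamilton; `χ_M` is monic, hence cancellable).
[cite: Soltys2002, §2 Lemma 2] -/
theorem adjugate_charmatrix (M : Matrix n n R) :
    (Matrix.charmatrix M).adjugate = ∑ k ∈ range (Fintype.card n + 1),
      C (M.charpoly.coeff k) • ∑ l ∈ range k, (X : R[X]) ^ l • (M ^ (k - (l + 1))).map C := by
  nontriviality R
  have hdeg : M.charpoly.natDegree < Fintype.card n + 1 := by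
    rw [Matrix.charpoly_natDegree_eq_dim]; exact Nat.lt_succ_self _
  set B := ∑ k ∈ range (Fintype.card n + 1),
      C (M.charpoly.coeff k) • ∑ l ∈ range k, (X : R[X]) ^ l • (M ^ (k - (l + 1))).map C with hB
  have hY : ∀ j : ℕ, (M ^ j).map (C : R → R[X]) = (M.map C) ^ j := fun j =>
    Matrix.map_pow M (C : R →+* R[X]) j
  -- (1) `(X·1 − M) · B = χ_M · 1`
  have h1 : Matrix.charmatrix M * B = M.charpoly • (1 : Matrix n n R[X]) := by
    rw [hB, Finset.mul_sum]
    have hk : ∀ k ∈ range (Fintype.card n + 1), Matrix.charmatrix M *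
        (C (M.charpoly.coeff k) • ∑ l ∈ range k, (X : R[X]) ^ l • (M ^ (k - (l + 1))).map C) =
        C (M.charpoly.coeff k) • ((X : R[X]) ^ k • (1 : Matrix n n R[X])) -
          C (M.charpoly.coeff k) • (M ^ k).map C := by
      intro k _
      rw [Matrix.mul_smul, ← smul_sub]
      refine congrArg (C (M.charpoly.coeff k) • ·) ?_
      simp_rw [hY]
      rw [charmatrix_eq_X_smul_one_sub]
      exact X_smul_one_sub_mul_sum _ k
    rw [Finset.sum_congr rfl hk, Finset.sum_sub_distrib]
    have hp : ∑ k ∈ range (Fintype.card n + 1),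
        C (M.charpoly.coeff k) • ((X : R[X]) ^ k • (1 : Matrix n n R[X])) =
          M.charpoly • (1 : Matrix n n R[X]) := by
      simp_rw [smul_smul, ← Finset.sum_smul]
      refine congrArg (· • (1 : Matrix n n R[X])) ?_
      simp_rw [C_mul_X_pow_eq_monomial]
      exact (M.charpoly.as_sum_range' (Fintype.card n + 1) hdeg).symm
    have hq : ∑ k ∈ range (Fintype.card n + 1),
        C (M.charpoly.coeff k) • (M ^ k).map (C : R → R[X]) = 0 := by
      have h0 : ∑ k ∈ range (Fintype.card n + 1), M.charpoly.coeff k • M ^ k = 0 := by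
        rw [← Polynomial.aeval_eq_sum_range' hdeg, Matrix.aeval_self_charpoly]
      refine Matrix.ext fun i j => ?_
      have hij := congrFun (congrFun h0 i) j
      simp only [Matrix.sum_apply, Matrix.smul_apply, smul_eq_mul, Matrix.zero_apply] at hij
      simp only [Matrix.sum_apply, Matrix.smul_apply, Matrix.map_apply, smul_eq_mul,
        Matrix.zero_apply]
      rw [show (∑ k ∈ range (Fintype.card n + 1), C (M.charpoly.coeff k) * C ((M ^ k) i j)) =
          C (∑ k ∈ range (Fintype.card n + 1), M.charpoly.coeff k * (M ^ k) i j) by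
        rw [map_sum]; simp only [map_mul], hij, map_zero]
    rw [hp, hq, sub_zero]
  -- (2) cancel the monic polynomial `χ_M`
  have h2 : M.charpoly • (Matrix.charmatrix M).adjugate = M.charpoly • B := by
    have h3 : (Matrix.charmatrix M).adjugate * (Matrix.charmatrix M * B) =
        (Matrix.charmatrix M).adjugate * (M.charpoly • (1 : Matrix n n R[X])) := by rw [h1]
    rw [← mul_assoc, Matrix.adjugate_mul, Matrix.smul_mul, one_mul, Matrix.mul_smul,
      mul_one] at h3
    exact h3.symm
  refine Matrix.ext fun i j => ?_
  have hij := congrFun (congrFun h2 i) j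
  simp only [Matrix.smul_apply, smul_eq_mul] at hij
  have h4 : M.charpoly * ((Matrix.charmatrix M).adjugate i j - B i j) = 0 := by
    rw [mul_sub, hij, sub_self]
  exact sub_eq_zero.1 ((Matrix.charpoly_monic M).mul_right_eq_zero_iff.1 h4)

/-- Entrywise form of `adjugate_charmatrix`. [cite: Soltys2002, §2 Lemma 2] -/
theorem adjugate_charmatrix_apply (M : Matrix n n R) (i j : n) :
    (Matrix.charmatrix M).adjugate i j = ∑ k ∈ range (Fintype.card n + 1), ∑ l ∈ range k,
      C (M.charpoly.coeff k) * X ^ l * C ((M ^ (k - (l + 1))) i j) := by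
  rw [adjugate_charmatrix, Matrix.sum_apply]
  refine Finset.sum_congr rfl fun k _ => ?_
  rw [Matrix.smul_apply, Matrix.sum_apply, smul_eq_mul, Finset.mul_sum]
  refine Finset.sum_congr rfl fun l _ => ?_
  rw [Matrix.smul_apply, Matrix.map_apply, smul_eq_mul, mul_assoc]

/-- The bilinear form `R · adj(X·1 − M) · S` as a polynomial: its coefficients are the numbers
`c_k · (R M^{k-1-l} S)` (Soltys 2002, §2, from Lemma 2). [cite: Soltys2002, §2 Lemma 2] -/
theorem sum_C_mul_adjugate_charmatrix_mul_C (M : Matrix n n R) (r c : n → R) :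
    ∑ j, ∑ i, C (r j) * (Matrix.charmatrix M).adjugate j i * C (c i) =
      ∑ k ∈ range (Fintype.card n + 1), ∑ l ∈ range k,
        C (M.charpoly.coeff k * ∑ j, ∑ i, r j * (M ^ (k - (l + 1))) j i * c i) * X ^ l := by
  simp_rw [adjugate_charmatrix_apply, Finset.mul_sum, Finset.sum_mul]
  calc ∑ j, ∑ i, ∑ k ∈ range (Fintype.card n + 1), ∑ l ∈ range k,
        C (r j) * (C (M.charpoly.coeff k) * X ^ l * C ((M ^ (k - (l + 1))) j i)) * C (c i)
      = ∑ j, ∑ k ∈ range (Fintype.card n + 1), ∑ i, ∑ l ∈ range k,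
        C (r j) * (C (M.charpoly.coeff k) * X ^ l * C ((M ^ (k - (l + 1))) j i)) * C (c i) :=
        Finset.sum_congr rfl fun j _ => Finset.sum_comm
    _ = ∑ k ∈ range (Fintype.card n + 1), ∑ j, ∑ i, ∑ l ∈ range k,
        C (r j) * (C (M.charpoly.coeff k) * X ^ l * C ((M ^ (k - (l + 1))) j i)) * C (c i) :=
        Finset.sum_comm
    _ = ∑ k ∈ range (Fintype.card n + 1), ∑ j, ∑ l ∈ range k, ∑ i,
        C (r j) * (C (M.charpoly.coeff k) * X ^ l * C ((M ^ (k - (l + 1))) j i)) * C (c i) :=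
        Finset.sum_congr rfl fun k _ => Finset.sum_congr rfl fun j _ => Finset.sum_comm
    _ = ∑ k ∈ range (Fintype.card n + 1), ∑ l ∈ range k, ∑ j, ∑ i,
        C (r j) * (C (M.charpoly.coeff k) * X ^ l * C ((M ^ (k - (l + 1))) j i)) * C (c i) :=
        Finset.sum_congr rfl fun k _ => Finset.sum_comm
    _ = _ := by
        refine Finset.sum_congr rfl fun k _ => Finset.sum_congr rfl fun l _ => ?_
        have h : ∀ j i, C (r j) * (C (M.charpoly.coeff k) * X ^ l * C ((M ^ (k - (l + 1))) j i)) *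
            C (c i) = C (M.charpoly.coeff k) * C (r j * (M ^ (k - (l + 1))) j i * c i) * X ^ l := by
          intro j i
          simp only [map_mul]
          ring
        simp_rw [h, ← Finset.sum_mul, ← Finset.mul_sum, ← map_sum, ← map_mul]

end Adjugate

/-! ### Berkowitz's recursion -/

section Berkowitz

variable {m : ℕ}

/-- **Berkowitz's recursion** (polynomial form): for `A = [[M, S], [R, a]]` bordered by its last
row and column and `χ_M = ∑_k c_k X^k`,
`χ_A = (X − a) χ_M − ∑_{k ≤ m} ∑_{l < k} c_k · (R M^{k-1-l} S) · X^l`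
(Soltys 2002, §2, eq. (eq:berk) from Lemmas 1–2; Berkowitz 1984).
[cite: Soltys2002, §2 eq. (eq:berk)] -/
theorem charpoly_eq_berkowitz (A : Matrix (Fin (m + 1)) (Fin (m + 1)) R) :
    A.charpoly =
      (X - C (A (Fin.last m) (Fin.last m))) * (A.submatrix Fin.castSucc Fin.castSucc).charpoly -
        ∑ k ∈ range (m + 1), ∑ l ∈ range k,
          C ((A.submatrix Fin.castSucc Fin.castSucc).charpoly.coeff k *
              ∑ j, ∑ i, A (Fin.last m) (Fin.castSucc j) *
                ((A.submatrix Fin.castSucc Fin.castSucc) ^ (k - (l + 1))) j i *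
                  A (Fin.castSucc i) (Fin.last m)) * X ^ l := by
  rw [charpoly_eq_samuelson, sum_C_mul_adjugate_charmatrix_mul_C
    (A.submatrix Fin.castSucc Fin.castSucc) (fun j => A (Fin.last m) (Fin.castSucc j))
    (fun i => A (Fin.castSucc i) (Fin.last m)), Fintype.card_fin]

/-- **Berkowitz's recursion, coefficientwise** — one row of the product `χ_A = C · χ_M` with
Berkowitz's lower-triangular Toeplitz matrix `C = Toeplitz(1, −a, −RS, −RMS, −RM²S, …)`
(Soltys 2002, §2, Def. 2 and Example 2; Berkowitz 1984): for every `l`,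
`[X^l] χ_A = [X^{l-1}] χ_M − a · [X^l] χ_M − ∑_{l < k ≤ m} [X^k] χ_M · (R M^{k-l-1} S)`
(with `[X^{-1}] := 0`). [cite: Soltys2002, §2 Def. 2] [cite: Berkowitz1984, §2] -/
theorem charpoly_coeff_eq_berkowitz (A : Matrix (Fin (m + 1)) (Fin (m + 1)) R) (l : ℕ) :
    A.charpoly.coeff l =
      (if l = 0 then 0 else (A.submatrix Fin.castSucc Fin.castSucc).charpoly.coeff (l - 1)) -
        A (Fin.last m) (Fin.last m) * (A.submatrix Fin.castSucc Fin.castSucc).charpoly.coeff l -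
        ∑ k ∈ Ioc l m, (A.submatrix Fin.castSucc Fin.castSucc).charpoly.coeff k *
          ∑ j, ∑ i, A (Fin.last m) (Fin.castSucc j) *
            ((A.submatrix Fin.castSucc Fin.castSucc) ^ (k - (l + 1))) j i *
              A (Fin.castSucc i) (Fin.last m) := by
  rw [charpoly_eq_berkowitz, coeff_sub, sub_mul, coeff_sub, coeff_C_mul, finsetSum_coeff]
  refine congrArg₂ (· - ·) (congrArg₂ (· - ·) ?_ rfl) ?_
  · cases l with
    | zero => simp
    | succ l => simp [coeff_X_mul]
  · have h : ∀ k : ℕ, (∑ l' ∈ range k,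
        C ((A.submatrix Fin.castSucc Fin.castSucc).charpoly.coeff k *
            ∑ j, ∑ i, A (Fin.last m) (Fin.castSucc j) *
              ((A.submatrix Fin.castSucc Fin.castSucc) ^ (k - (l' + 1))) j i *
                A (Fin.castSucc i) (Fin.last m)) * X ^ l').coeff l =
        if l < k then (A.submatrix Fin.castSucc Fin.castSucc).charpoly.coeff k *
            ∑ j, ∑ i, A (Fin.last m) (Fin.castSucc j) *
              ((A.submatrix Fin.castSucc Fin.castSucc) ^ (k - (l + 1))) j i *
                A (Fin.castSucc i) (Fin.last m) else 0 := by
      intro k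
      rw [finsetSum_coeff]
      simp_rw [coeff_C_mul_X_pow]
      rw [Finset.sum_ite_eq]
      simp only [mem_range]
    simp_rw [h]
    rw [← Finset.sum_filter]
    exact Finset.sum_congr (by ext k; simp only [mem_filter, mem_range, mem_Ioc]; omega)
      fun _ _ => rfl

end Berkowitz

end Literature.LinearAlgebra.Matrix
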